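import Literature.NumberTheory.GaloisRepresentations.ArtinFormalismProofs
import Literature.NumberTheory.GaloisRepresentations.ArtinConductorHerbrandProofs
import Literature.NumberTheory.GaloisRepresentations.ArtinConductorExponentHasseArfProofs
import Literature.NumberTheory.GaloisRepresentations.ArtinRestriction
import HarnessLib

/-!
# The Artin formalism for the completed L-function: additivity in direct sums (proofs)
(companion to `Literature.NumberTheory.GaloisRepresentations.ArtinFormalism` and
`Literature.NumberTheory.GaloisRepresentations.ArtinLFunction`; serves the named fact
`Literature.NumberTheory.Automorphic.brauer_completedArtinLFunction_eq_prod_zpow` of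
`Automorphic/ArtinLFunctionsFunctionalEquation`, Neukirch VII (12.3) (i))

Neukirch, *Algebraic Number Theory*, VII (12.3) (i): `Λ(L|K, χ + χ', s) = Λ(L|K, χ, s) Λ(L|K, χ', s)`
for the completed Artin L-series `Λ = c^{s/2} 𝓛_∞ 𝓛` (Def. (12.2)), from the additivity of its
three factors: (11.7) (i) `𝔣(χ + χ') = 𝔣(χ) 𝔣(χ')` (whence (11.11) (i)
`c(L|K, χ + χ') = c(L|K, χ) c(L|K, χ')`), (12.1) (i)
`𝓛_𝔭(L|K, χ + χ', s) = 𝓛_𝔭(L|K, χ, s) 𝓛_𝔭(L|K, χ', s)` ("trivial"), and (10.4) (ii) for `𝓛`.  For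
the tree's `completedArtinLFunction` of the direct sum `ρ ⊕ ρ'` (`ContinuousRep.prod`) of two
Artin representations of `K` this file **proves**:

* `finrank_eigenspace_prodMap`, `ArtinRep.signature_prod`, `ArtinRep.gammaFactor_prod` — (12.1) (i):
  signatures add and `γ(ρ ⊕ ρ', s) = γ(ρ, s) γ(ρ', s)`;
* `ContinuousRep.codimFixed_prod`, `ArtinRep.artinConductorAt_prod` — (11.7) (i) at the level of the
  local conductors `a_𝔓(ρ) = codim V^{I_𝔓} + sw_𝔓(ρ)`: **unconditionally**
  `a_𝔓(ρ ⊕ ρ') = a_𝔓(ρ) + a_𝔓(ρ')` for Artin representations with their module topologies, via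
  the lower-numbering formula `a_𝔓(ρ) = Σᵢ (#Gᵢ/#G₀) codim V^{Gᵢ}` over a finite Galois group
  `Gal(E/K)` through which both `ρ` and `ρ'` factor
  (`GaloisRep.artinConductorAt_eq_finsum_ramificationSubgroup_holds`, Serre VI §2 Cor. 1');
* `ArtinRep.artinConductorExponent_prod_of_natCast`, `ArtinRep.artinConductor_prod_of_natCast`,
  `ArtinRep.artinConductorNorm_prod_of_natCast`, `completedArtinLFunction_prod_of_natCast` — the
  global statements (11.7) (i), (11.11) (i), (12.3) (i) for the tree's conductor *ideal*
  `𝔣(ρ) = ∏ v^{⌊a_𝔓(ρ)⌋₊}`, **granting the integrality of the local conductors** `a_𝔓(ρ) ∈ ℕ` of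
  `ρ` and `ρ'` (Artin's theorem, Serre VI §2 Thm. 1', i.e. Hasse–Arf): the floor in
  `GaloisRep.artinConductorExponent` is additive only on integers, so this hypothesis cannot be
  dropped for the tree's definition;
* `ArtinRep.natCast_artinConductorExponent_of_hasseArf`, `completedArtinLFunction_prod_of_hasseArf` —
  the same fed with the tree's reduction of integrality to the named fact `hasseArf`
  (`GaloisRep.natCast_artinConductorExponent_of_hasOpenInertiaKerAt_of_hasseArf_charZero`), so that
  (12.3) (i) holds for all Artin representations **conditionally on Hasse–Arf** only;
* `ArtinRep.isUnramifiedAE` — an Artin representation on a space with its module topology is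
  unramified almost everywhere (transport of `FramedGaloisRep.eventually_isUnramifiedAt_of_isOpen_ker`
  along a frame), which makes `𝔣(ρ)` a genuine finite product.

Everything here is proved; no new definitions or named facts.

## Mathlib / tree search

Mathlib: `LinearMap.prodMap`, `Module.finrank_prod`, `finsum_add_distrib`, `finprod_mul_distrib`,
`krullTopology_mem_nhds_one_iff_of_normal`, `Nat.floor_natCast`, `Ideal.absNorm` (`map_mul`),
`Complex.mul_cpow_ofReal_nonneg`.  Tree: `ContinuousRep.prod`, `fixedSubmoduleProdEquiv`,
`artinLFunction_prod'` (`ArtinFormalism(Proofs)`), `ArtinRep.isOpen_ker`,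
`GaloisRep.artinConductorAt_eq_finsum_ramificationSubgroup_holds` (`ArtinConductorHerbrandProofs`),
`ramificationSubgroup_comap_eventually_eq_bot` (`ArtinConductorIntegralityProofs`),
`artinConductorExponent_eq_zero_cofinite_holds` (`ArtinConductorProofs`); `lean search
'artinConductorAt_prod\|gammaFactor_prod\|signature_prod'`: nothing.  Nothing here duplicates an
existing declaration.

## References

* J. Neukirch, *Algebraic Number Theory* (1999), VII (10.4) (ii), (11.7) (i), (11.11) (i),
  (12.1) (i), (12.2)–(12.3) (`NeukirchANT1999`).
* J.-P. Serre, *Local Fields* (1979), Ch. VI §2, Cor. 1' and Thm. 1'; Ch. IV §3 (Hasse–Arf)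
  (`SerreLocalFields1979`).
-/

noncomputable section

open scoped NumberField
open Field IsDedekindDomain Module NumberField

namespace Literature.NumberTheory.GaloisRepresentations

universe u v w w'

/-! ### Eigenspaces in direct sums -/

section EigenspaceProd

variable {A : Type*} [Field A] {M : Type*} {N : Type*} [AddCommGroup M] [Module A M]
  [AddCommGroup N] [Module A N] [FiniteDimensional A M] [FiniteDimensional A N]

/-- The `μ`-eigenspace of `f ⊕ g` on `M × N` is the product of the `μ`-eigenspaces of `f` and
`g`; in particular its dimension is the sum of theirs.
Ref: Neukirch, *Algebraic Number Theory*, VII §12, proof of (12.1) (i) ("trivial"). [folklore] -/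
theorem finrank_eigenspace_prodMap (f : Module.End A M) (g : Module.End A N) (μ : A) :
    finrank A (Module.End.eigenspace (f.prodMap g) μ) =
      finrank A (Module.End.eigenspace f μ) + finrank A (Module.End.eigenspace g μ) := by
  have hmem : ∀ x : M × N, x ∈ Module.End.eigenspace (f.prodMap g) μ ↔
      x.1 ∈ Module.End.eigenspace f μ ∧ x.2 ∈ Module.End.eigenspace g μ := fun x => by
    simp only [Module.End.mem_eigenspace_iff, LinearMap.prodMap_apply, Prod.ext_iff, Prod.smul_fst,
      Prod.smul_snd]
  let e : Module.End.eigenspace (f.prodMap g) μ ≃ₗ[A]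
      Module.End.eigenspace f μ × Module.End.eigenspace g μ :=
    { toFun := fun x => (⟨x.1.1, ((hmem x.1).mp x.2).1⟩, ⟨x.1.2, ((hmem x.1).mp x.2).2⟩)
      invFun := fun y => ⟨(y.1.1, y.2.1), (hmem _).mpr ⟨y.1.2, y.2.2⟩⟩
      map_add' := fun _ _ => rfl
      map_smul' := fun _ _ => rfl
      left_inv := fun _ => rfl
      right_inv := fun _ => rfl }
  rw [e.finrank_eq, Module.finrank_prod]

end EigenspaceProd

/-! ### (12.1) (i): signatures and `Γ`-factors of a direct sum -/

namespace ArtinRep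

section Signature

variable {K : Type u} [Field K] {V : Type w} [AddCommGroup V] [Module ℂ V] [TopologicalSpace V]
  [FiniteDimensional ℂ V] {V' : Type w'} [AddCommGroup V'] [Module ℂ V'] [TopologicalSpace V']
  [FiniteDimensional ℂ V']

/-- **Signatures add in direct sums**: at every real embedding `φ`,
`(n⁺, n⁻)(ρ ⊕ ρ') = (n⁺, n⁻)(ρ) + (n⁺, n⁻)(ρ')` (the `±1`-eigenspaces of `(ρ ⊕ ρ')(c)` are the
products of those of `ρ(c)`, `ρ'(c)`).  Neukirch VII (12.1) (i) with
`n⁺ = (χ(1) + χ(φ_𝔓))/2`, `n⁻ = (χ(1) - χ(φ_𝔓))/2`, additive in `χ`.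
[cite: NeukirchANT1999, VII (12.1) (i)] -/
theorem signature_prod (ρ : ArtinRep K V) (ρ' : ArtinRep K V') (φ : K →+* ℝ) :
    ArtinRep.signature (V := V × V') (ρ.prod ρ') φ = ρ.signature φ + ρ'.signature φ := by
  unfold signature
  exact Prod.ext (finrank_eigenspace_prodMap _ _ _) (finrank_eigenspace_prodMap _ _ _)

variable [NumberField K]

/-- **Neukirch VII (12.1) (i): `Γ`-factors are multiplicative in direct sums**,
`γ(ρ ⊕ ρ', s) = γ(ρ, s) γ(ρ', s)` (`𝓛_𝔭(L|K, χ + χ', s) = 𝓛_𝔭(L|K, χ, s) 𝓛_𝔭(L|K, χ', s)` at every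
infinite place: the exponents `n⁺`, `n⁻`, `χ(1)` add). [cite: NeukirchANT1999, VII (12.1) (i)] -/
theorem gammaFactor_prod (ρ : ArtinRep K V) (ρ' : ArtinRep K V') (s : ℂ) :
    ArtinRep.gammaFactor (V := V × V') (ρ.prod ρ') s = ρ.gammaFactor s * ρ'.gammaFactor s := by
  simp only [gammaFactor]
  rw [← Finset.prod_mul_distrib]
  refine Finset.prod_congr rfl fun x _ => ?_
  split_ifs with hx
  · rw [signature_prod, Prod.fst_add, Prod.snd_add, pow_add, pow_add]
    ring
  · rw [Module.finrank_prod, pow_add]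

end Signature

end ArtinRep

/-! ### Codimensions of fixed subspaces in direct sums -/

namespace ContinuousRep

variable {G : Type*} [Group G] [TopologicalSpace G] {A : Type*} [Field A] [TopologicalSpace A]
  {M : Type*} [AddCommGroup M] [Module A M] [TopologicalSpace M] [FiniteDimensional A M]
  {N : Type*} [AddCommGroup N] [Module A N] [TopologicalSpace N] [FiniteDimensional A N]

/-- **`codim (M ⊕ N)^H = codim M^H + codim N^H`** (`(M × N)^H = M^H × N^H`,
`fixedSubmoduleProdEquiv`).  Ref: Serre, *Local Fields*, Ch. VI §2 (additivity of `f(χ)` in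
`χ`); Neukirch VII (11.7) (i). [folklore] -/
theorem codimFixed_prod (ρ : ContinuousRep G A M) (ρ' : ContinuousRep G A N) (H : Subgroup G) :
    (ρ.prod ρ').codimFixed H = ρ.codimFixed H + ρ'.codimFixed H := by
  rw [codimFixed_eq_finrank_sub, codimFixed_eq_finrank_sub, codimFixed_eq_finrank_sub,
    (fixedSubmoduleProdEquiv ρ ρ' H).finrank_eq, Module.finrank_prod, Module.finrank_prod]
  have h1 := Submodule.finrank_le (ρ.fixedSubmodule H)
  have h2 := Submodule.finrank_le (ρ'.fixedSubmodule H)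
  omega

end ContinuousRep

/-! ### (11.7) (i) for the local conductors `a_𝔓`, unconditionally -/

section ConductorAt

variable {K : Type u} [Field K] [NumberField K] {V : Type w} [AddCommGroup V] [Module ℂ V]
  [TopologicalSpace V] [FiniteDimensional ℂ V]
  {V' : Type w'} [AddCommGroup V'] [Module ℂ V'] [TopologicalSpace V'] [FiniteDimensional ℂ V']

omit [FiniteDimensional ℂ V] in
/-- The terms of the lower-numbering formula `Σᵢ (#Gᵢ/#G₀) codim V^{Gᵢ}` vanish for `i ≫ 0`
(`Gᵢ = 1` eventually, `ramificationSubgroup_comap_eventually_eq_bot`, and `ρ` is trivial on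
`Gal(K̄/E)`), so the sum has finite support.  Ref: Serre, *Local Fields*, Ch. IV §1 Prop. 1 and
Ch. VI §2 Cor. 1'. [folklore] -/
theorem ArtinRep.support_finsum_ramificationSubgroup_finite (τ : ArtinRep K V)
    (E : IntermediateField K (AlgebraicClosure K)) [FiniteDimensional K E] [Normal K E]
    (hτ : ∀ σ : absoluteGaloisGroup K, absRestrictNormalHom E σ = 1 → τ σ = 1)
    (𝔓 : Ideal (absIntegers (𝓞 K) K)) [𝔓.IsPrime] (c : ℕ → ℝ) :
    (Function.support fun i : ℕ => c i * (ContinuousRep.codimFixed τ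
      (((𝔓.comap (E.integralClosureToAbsIntegers (𝓞 K))).ramificationSubgroup (E ≃ₐ[K] E) i).comap
        (absRestrictNormalHom E)) : ℝ)).Finite := by
  haveI : Algebra.IsSeparable K E := Algebra.IsSeparable.of_integral K E
  obtain ⟨n₀, hn₀⟩ := ramificationSubgroup_comap_eventually_eq_bot (𝓞 K) 𝔓 E
  refine (Set.finite_Iio n₀).subset fun i hi => ?_
  rw [Function.mem_support] at hi
  by_contra hle
  rw [Set.mem_Iio, not_lt] at hle
  apply hi
  rw [hn₀ i hle, ContinuousRep.codimFixed_eq_zero_of_forall_eq_one τ fun σ hσ => hτ σ ?_,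
    Nat.cast_zero, mul_zero]
  rwa [Subgroup.mem_comap, Subgroup.mem_bot] at hσ

variable [IsModuleTopology ℂ V] [IsModuleTopology ℂ V']

/-- **Two Artin representations factor through a common finite Galois group**: there is a finite
normal subextension `E/K` of `K̄/K` with `ρ` and `ρ'` trivial on `Gal(K̄/E)` (the open subgroup
`ker ρ ∩ ker ρ'` of the profinite group `Γ_K` contains some `Gal(K̄/E)`,
Mathlib `krullTopology_mem_nhds_one_iff_of_normal`; `ArtinRep.isOpen_ker`).
Ref: Neukirch, *Algebraic Number Theory*, VII §10 (Artin representations as representations of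
finite Galois groups `G(L|K)`; enlarge `L`). [folklore] -/
theorem ArtinRep.exists_normal_forall_apply_eq_one₂ (ρ : ArtinRep K V) (ρ' : ArtinRep K V') :
    ∃ (E : IntermediateField K (AlgebraicClosure K)) (_ : FiniteDimensional K E) (_ : Normal K E),
      (∀ σ : absoluteGaloisGroup K, absRestrictNormalHom E σ = 1 → ρ σ = 1) ∧
      (∀ σ : absoluteGaloisGroup K, absRestrictNormalHom E σ = 1 → ρ' σ = 1) := by
  have hU : IsOpen (((ρ.ker ⊓ ρ'.ker : Subgroup (absoluteGaloisGroup K)) :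
      Set (absoluteGaloisGroup K))) := by
    rw [Subgroup.coe_inf]
    exact ρ.isOpen_ker.inter ρ'.isOpen_ker
  have h1 : ((ρ.ker ⊓ ρ'.ker : Subgroup (absoluteGaloisGroup K)) : Set (absoluteGaloisGroup K)) ∈
      nhds (1 : absoluteGaloisGroup K) := hU.mem_nhds (Subgroup.one_mem _)
  obtain ⟨E, hEfd, hEn, hE⟩ :=
    (krullTopology_mem_nhds_one_iff_of_normal K (AlgebraicClosure K) _).mp h1
  haveI := hEn
  have hker : ∀ σ : absoluteGaloisGroup K, absRestrictNormalHom E σ = 1 → σ ∈ ρ.ker ⊓ ρ'.ker := by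
    intro σ hσ
    have hmem : absoluteGaloisGroup.toAlgEquiv K σ ∈ E.fixingSubgroup := by
      rw [← IntermediateField.restrictNormalHom_ker, MonoidHom.mem_ker]
      exact hσ
    exact hE hmem
  refine ⟨E, hEfd, hEn, fun σ hσ => ?_, fun σ hσ => ?_⟩
  · exact ((ρ.mem_ker σ).mp (hker σ hσ).1).trans Module.End.one_eq_id.symm
  · exact ((ρ'.mem_ker σ).mp (hker σ hσ).2).trans Module.End.one_eq_id.symm

/-- **Neukirch VII (11.7) (i) for the local Artin conductors, unconditionally**: for Artin
representations `ρ`, `ρ'` of the number field `K` (module topologies) and every prime `𝔓 ∣ v` of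
`\bar ℤ_K`, `a_𝔓(ρ ⊕ ρ') = a_𝔓(ρ) + a_𝔓(ρ')` (`GaloisRep.artinConductorAt`, inertia codimension
plus Swan conductor).  Proof: both representations, and their sum, factor through a common finite
Galois group `Gal(E/K)` (`exists_normal_forall_apply_eq_one₂`), for which
`a_𝔓 = Σᵢ (#Gᵢ/#G₀) codim V^{Gᵢ}` (`GaloisRep.artinConductorAt_eq_finsum_ramificationSubgroup_holds`,
Serre VI §2 Cor. 1'), and `codim` is additive (`ContinuousRep.codimFixed_prod`).  In Neukirch,
`f(χ) = Σᵢ (gᵢ/g₀) codim V^{Gᵢ}` is visibly additive in `χ` ((11.6)–(11.7)).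
[cite: NeukirchANT1999, VII (11.7) (i)] [cite: SerreLocalFields1979, Ch. VI §2, Cor. 1'] -/
theorem ArtinRep.artinConductorAt_prod (ρ : ArtinRep K V) (ρ' : ArtinRep K V')
    {v : HeightOneSpectrum (𝓞 K)} {𝔓 : Ideal (absIntegers (𝓞 K) K)} (h𝔓 : 𝔓 ∈ v.primesAbove) :
    GaloisRep.artinConductorAt (𝓞 K) 𝔓 (M := V × V') (ρ.prod ρ') =
      GaloisRep.artinConductorAt (𝓞 K) 𝔓 ρ + GaloisRep.artinConductorAt (𝓞 K) 𝔓 ρ' := by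
  obtain ⟨E, hEfd, hEn, hρ, hρ'⟩ := ArtinRep.exists_normal_forall_apply_eq_one₂ ρ ρ'
  haveI := hEfd
  haveI := hEn
  haveI : 𝔓.IsPrime := h𝔓.1
  have hρρ' : ∀ σ : absoluteGaloisGroup K, absRestrictNormalHom E σ = 1 →
      (ρ.prod ρ') σ = 1 := by
    intro σ hσ
    change (ρ σ : Module.End ℂ V).prodMap (ρ' σ : Module.End ℂ V') = 1
    rw [hρ σ hσ, hρ' σ hσ, LinearMap.prodMap_one]
  rw [GaloisRep.artinConductorAt_eq_finsum_ramificationSubgroup_holds h𝔓 E (ρ.prod ρ') hρρ',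
    GaloisRep.artinConductorAt_eq_finsum_ramificationSubgroup_holds h𝔓 E ρ hρ,
    GaloisRep.artinConductorAt_eq_finsum_ramificationSubgroup_holds h𝔓 E ρ' hρ']
  simp_rw [ContinuousRep.codimFixed_prod, Nat.cast_add, mul_add]
  exact finsum_add_distrib (ArtinRep.support_finsum_ramificationSubgroup_finite ρ E hρ 𝔓 _)
    (ArtinRep.support_finsum_ramificationSubgroup_finite ρ' E hρ' 𝔓 _)

end ConductorAt

/-! ### Artin representations are unramified almost everywhere -/

section UnramifiedAE

variable {K : Type u} [Field K] [NumberField K] {V : Type w} [AddCommGroup V] [Module ℂ V]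
  [TopologicalSpace V] [FiniteDimensional ℂ V] [IsModuleTopology ℂ V]

/-- **An Artin representation is unramified at all but finitely many places** (abstract `V`
with its module topology): `ρ` is equivalent to a framed representation `ρ₀ : Γ_K → GL_d(ℂ)`
(`ContinuousRep.exists_framedRep_holds`) whose kernel, equal to `ker ρ`, is open
(`ArtinRep.isOpen_ker`), so `ρ₀` is unramified almost everywhere
(`FramedGaloisRep.eventually_isUnramifiedAt_of_isOpen_ker`: the finitely many ramified places lie
below the different of `K̄^{ker ρ}/K`), and `ρ(I_𝔓) = 1 ↔ ρ₀(I_𝔓) = 1`.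
Ref: Serre, *Abelian ℓ-adic representations and elliptic curves* (1968), Ch. I §2.1;
Neukirch, *Algebraic Number Theory*, Ch. III §2, Thm. (2.6). [cite: SerreAbelianLadic1968, Ch. I §2.1] -/
theorem ArtinRep.isUnramifiedAE (ρ : ArtinRep K V) : GaloisRep.IsUnramifiedAE ρ := by
  obtain ⟨d, ρf, ⟨e⟩⟩ :=
    ContinuousRep.exists_framedRep_holds (G := absoluteGaloisGroup K) (A := ℂ) (M := V) ρ
  -- `ρ₀ σ = 1 ↔ ρ σ = 1`
  have hiff : ∀ σ : absoluteGaloisGroup K, ρf σ = 1 ↔ ρ σ = 1 := by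
    intro σ
    have h1 : ρf σ = 1 ↔ FramedRep.toContinuousRep ρf σ = 1 := by
      change ρf σ = 1 ↔ FramedRep.toRepresentation ρf σ = 1
      constructor
      · intro h
        refine LinearMap.ext fun x => ?_
        simp [h]
      · intro h
        have h2 : Matrix.toLin' ((ρf σ : GL (Fin d) ℂ) : Matrix (Fin d) (Fin d) ℂ) =
            Matrix.toLin' 1 := by
          rw [Matrix.toLin'_one]
          refine LinearMap.ext fun x => ?_
          simpa using congr($h x)
        exact Units.ext (Matrix.toLin'.injective h2)
    rw [h1]
    constructor
    · intro h
      refine LinearMap.ext fun y => ?_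
      obtain ⟨x, rfl⟩ := e.toLinearEquiv.surjective y
      rw [← e.apply_apply, h, Module.End.one_apply, Module.End.one_apply]
    · intro h
      refine LinearMap.ext fun x => ?_
      apply e.toLinearEquiv.injective
      rw [e.apply_apply, h, Module.End.one_apply, Module.End.one_apply]
  -- the kernel of `ρ₀` is open
  have hker : IsOpen ((ρf.toMonoidHom.ker : Subgroup (absoluteGaloisGroup K)) :
      Set (absoluteGaloisGroup K)) := by
    have hset : (ρf.toMonoidHom.ker : Set (absoluteGaloisGroup K)) = ρ.ker := by
      ext σ
      rw [SetLike.mem_coe, SetLike.mem_coe, MonoidHom.mem_ker, ContinuousRep.mem_ker,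
        ← Module.End.one_eq_id]
      exact hiff σ
    rw [hset]
    exact ρ.isOpen_ker
  have hev := FramedGaloisRep.eventually_isUnramifiedAt_of_isOpen_ker (F := K) ρf hker
  rw [Filter.eventually_cofinite] at hev
  refine ⟨_, hev, fun v hv => ?_⟩
  simp only [Set.mem_setOf_eq, not_not] at hv
  intro 𝔓 h𝔓 σ hσ
  exact (hiff σ).mp (hv 𝔓 h𝔓 σ hσ)

/-- Consequently the conductor exponents `a_v(ρ)` of an Artin representation vanish for all but
finitely many `v` (`artinConductorExponent_eq_zero_cofinite_holds`), i.e. the conductor ideal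
`𝔣(ρ) = ∏ v^{a_v(ρ)}` is a genuine finite product.  Ref: Serre, *Local Fields*, Ch. VI §3. [folklore] -/
theorem ArtinRep.mulSupport_artinConductor_finite (ρ : ArtinRep K V) :
    (Function.mulSupport fun v : HeightOneSpectrum (𝓞 K) =>
      v.asIdeal ^ GaloisRep.artinConductorExponent v ρ).Finite := by
  have h := GaloisRep.artinConductorExponent_eq_zero_cofinite_holds ρ.isUnramifiedAE
  rw [Filter.eventually_cofinite] at h
  refine h.subset fun v hv => ?_
  rw [Function.mem_mulSupport] at hv
  rw [Set.mem_setOf_eq]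
  intro h0
  exact hv (by rw [h0, pow_zero])

end UnramifiedAE

/-! ### (11.7) (i), (11.11) (i), (12.3) (i) granting the integrality of the local conductors -/

section Global

variable {K : Type u} [Field K] [NumberField K] {V : Type w} [AddCommGroup V] [Module ℂ V]
  [TopologicalSpace V] [FiniteDimensional ℂ V] [IsModuleTopology ℂ V]
  {V' : Type w'} [AddCommGroup V'] [Module ℂ V'] [TopologicalSpace V'] [FiniteDimensional ℂ V']
  [IsModuleTopology ℂ V']

/-- **Conductor exponents add in direct sums, granting integrality**: if the local conductors
`a_𝔓(ρ)`, `a_𝔓(ρ')` at the primes above `v` are natural numbers (Artin's theorem, Serre VI §2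
Thm. 1'), then `a_v(ρ ⊕ ρ') = a_v(ρ) + a_v(ρ')` for the tree's exponents `a_v = ⌊a_𝔓⌋₊`
(`artinConductorAt_prod` and `⌊n + n'⌋₊ = n + n'`).  Without integrality the floor is not additive,
which is why the hypothesis is kept.  Ref: Neukirch, *Algebraic Number Theory*, VII (11.7) (i);
Serre, *Local Fields*, Ch. VI §2 Thm. 1'. [cite: NeukirchANT1999, VII (11.7) (i)] -/
theorem ArtinRep.artinConductorExponent_prod_of_natCast (ρ : ArtinRep K V) (ρ' : ArtinRep K V')
    (v : HeightOneSpectrum (𝓞 K))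
    (hρ : ∀ 𝔓 ∈ v.primesAbove, ∃ n : ℕ, (n : ℝ) = GaloisRep.artinConductorAt (𝓞 K) 𝔓 ρ)
    (hρ' : ∀ 𝔓 ∈ v.primesAbove, ∃ n : ℕ, (n : ℝ) = GaloisRep.artinConductorAt (𝓞 K) 𝔓 ρ') :
    GaloisRep.artinConductorExponent v (M := V × V') (ρ.prod ρ') =
      GaloisRep.artinConductorExponent v ρ + GaloisRep.artinConductorExponent v ρ' := by
  obtain ⟨n, hn⟩ := hρ _ (HeightOneSpectrum.primesAbove_nonempty v).some_mem
  obtain ⟨n', hn'⟩ := hρ' _ (HeightOneSpectrum.primesAbove_nonempty v).some_mem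
  unfold GaloisRep.artinConductorExponent
  rw [ArtinRep.artinConductorAt_prod ρ ρ' (HeightOneSpectrum.primesAbove_nonempty v).some_mem,
    ← hn, ← hn', ← Nat.cast_add, Nat.floor_natCast, Nat.floor_natCast, Nat.floor_natCast]

/-- **Neukirch VII (11.7) (i), `𝔣(χ + χ') = 𝔣(χ) 𝔣(χ')`, granting integrality**: for Artin
representations `ρ`, `ρ'` of `K` whose local conductors are natural numbers at every prime,
`𝔣(ρ ⊕ ρ') = 𝔣(ρ) 𝔣(ρ')` (`GaloisRep.artinConductor`, a finite product by
`mulSupport_artinConductor_finite`; Mathlib `finprod_mul_distrib`).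
[cite: NeukirchANT1999, VII (11.7) (i)] [cite: SerreLocalFields1979, Ch. VI §2 Thm. 1' and §3] -/
theorem ArtinRep.artinConductor_prod_of_natCast (ρ : ArtinRep K V) (ρ' : ArtinRep K V')
    (hρ : ∀ (v : HeightOneSpectrum (𝓞 K)), ∀ 𝔓 ∈ v.primesAbove,
      ∃ n : ℕ, (n : ℝ) = GaloisRep.artinConductorAt (𝓞 K) 𝔓 ρ)
    (hρ' : ∀ (v : HeightOneSpectrum (𝓞 K)), ∀ 𝔓 ∈ v.primesAbove,
      ∃ n : ℕ, (n : ℝ) = GaloisRep.artinConductorAt (𝓞 K) 𝔓 ρ') :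
    GaloisRep.artinConductor (M := V × V') (ρ.prod ρ') =
      GaloisRep.artinConductor ρ * GaloisRep.artinConductor ρ' := by
  unfold GaloisRep.artinConductor
  rw [← finprod_mul_distrib ρ.mulSupport_artinConductor_finite ρ'.mulSupport_artinConductor_finite]
  refine finprod_congr fun v => ?_
  rw [ArtinRep.artinConductorExponent_prod_of_natCast ρ ρ' v (hρ v) (hρ' v), pow_add]

/-- **Neukirch VII (11.11) (i), `c(L|K, χ + χ') = c(L|K, χ) c(L|K, χ')`, granting integrality**:
`A(ρ ⊕ ρ') = A(ρ) A(ρ')` for `A(ρ) = |d_K|^{dim V} N𝔣(ρ)` (`ArtinRep.artinConductorNorm`;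
`artinConductor_prod_of_natCast`, multiplicativity of `Ideal.absNorm`, `dim (V ⊕ V') = dim V + dim V'`).
[cite: NeukirchANT1999, VII (11.11) (i)] -/
theorem ArtinRep.artinConductorNorm_prod_of_natCast (ρ : ArtinRep K V) (ρ' : ArtinRep K V')
    (hρ : ∀ (v : HeightOneSpectrum (𝓞 K)), ∀ 𝔓 ∈ v.primesAbove,
      ∃ n : ℕ, (n : ℝ) = GaloisRep.artinConductorAt (𝓞 K) 𝔓 ρ)
    (hρ' : ∀ (v : HeightOneSpectrum (𝓞 K)), ∀ 𝔓 ∈ v.primesAbove,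
      ∃ n : ℕ, (n : ℝ) = GaloisRep.artinConductorAt (𝓞 K) 𝔓 ρ') :
    ArtinRep.artinConductorNorm (V := V × V') (ρ.prod ρ') =
      ρ.artinConductorNorm * ρ'.artinConductorNorm := by
  rw [ArtinRep.artinConductorNorm, ArtinRep.artinConductorNorm, ArtinRep.artinConductorNorm,
    GaloisRep.artinConductorNat, GaloisRep.artinConductorNat, GaloisRep.artinConductorNat,
    ArtinRep.artinConductor_prod_of_natCast ρ ρ' hρ hρ', map_mul, Module.finrank_prod, pow_add]
  ring

/-- **Neukirch VII (12.3) (i), `Λ(L|K, χ + χ', s) = Λ(L|K, χ, s) Λ(L|K, χ', s)` on `re s > 1`,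
granting integrality of the local conductors**: for Artin representations `ρ`, `ρ'` of `K` (module
topologies) with `a_𝔓(ρ), a_𝔓(ρ') ∈ ℕ` at all primes,
`Λ(s, ρ ⊕ ρ') = Λ(s, ρ) Λ(s, ρ')` for `re s > 1` — from `artinConductorNorm_prod_of_natCast`
((11.11) (i); `(A A')^{s/2} = A^{s/2} A'^{s/2}` for the natural numbers `A, A'`,
Mathlib `Complex.mul_cpow_ofReal_nonneg`), `gammaFactor_prod` ((12.1) (i)) and
`artinLFunction_prod'` ((10.4) (ii)).
[cite: NeukirchANT1999, VII (12.3) (i)] -/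
theorem completedArtinLFunction_prod_of_natCast (ρ : ArtinRep K V) (ρ' : ArtinRep K V')
    (hρ : ∀ (v : HeightOneSpectrum (𝓞 K)), ∀ 𝔓 ∈ v.primesAbove,
      ∃ n : ℕ, (n : ℝ) = GaloisRep.artinConductorAt (𝓞 K) 𝔓 ρ)
    (hρ' : ∀ (v : HeightOneSpectrum (𝓞 K)), ∀ 𝔓 ∈ v.primesAbove,
      ∃ n : ℕ, (n : ℝ) = GaloisRep.artinConductorAt (𝓞 K) 𝔓 ρ') {s : ℂ} (hs : 1 < s.re) :
    completedArtinLFunction (V := V × V') (ρ.prod ρ') s =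
      completedArtinLFunction ρ s * completedArtinLFunction ρ' s := by
  rw [completedArtinLFunction, completedArtinLFunction, completedArtinLFunction,
    ArtinRep.artinConductorNorm_prod_of_natCast ρ ρ' hρ hρ', ArtinRep.gammaFactor_prod,
    artinLFunction_prod' ρ ρ' hs, Nat.cast_mul]
  have hA : ((ρ.artinConductorNorm : ℕ) : ℂ) = ((ρ.artinConductorNorm : ℝ) : ℂ) := by norm_cast
  have hA' : ((ρ'.artinConductorNorm : ℕ) : ℂ) = ((ρ'.artinConductorNorm : ℝ) : ℂ) := by norm_cast
  rw [hA, hA', Complex.mul_cpow_ofReal_nonneg (Nat.cast_nonneg _) (Nat.cast_nonneg _)]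
  ring

end Global

/-! ### Conditionally on Hasse–Arf only -/

section HasseArf

variable {K : Type u} [Field K] [NumberField K] {V : Type w} [AddCommGroup V] [Module ℂ V]
  [TopologicalSpace V] [FiniteDimensional ℂ V] [IsModuleTopology ℂ V]
  {V' : Type w'} [AddCommGroup V'] [Module ℂ V'] [TopologicalSpace V'] [FiniteDimensional ℂ V']
  [IsModuleTopology ℂ V']

/-- **Integrality of the local conductors of an Artin representation from Hasse–Arf**: granting
the Hasse–Arf theorem (the named fact `hasseArf`, for all `(R', K', L')` in the universe of `K`),
`a_𝔓(ρ) ∈ ℕ` — indeed `(a_v(ρ) : ℝ) = a_𝔓(ρ)` — for every Artin representation `ρ` of `K` on a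
space with its module topology and every `𝔓 ∣ v` (the tree's
`GaloisRep.natCast_artinConductorExponent_of_hasOpenInertiaKerAt_of_hasseArf_charZero`, Katz 1.9 /
Serre VI §2 Thm. 1', fed with the open kernel of `ρ`).
[cite: SerreLocalFields1979, Ch. VI §2 Thm 1' and Ch. IV §3, Theorem (Hasse–Arf)] -/
theorem ArtinRep.natCast_artinConductorExponent_of_hasseArf
    (hHA : ∀ (R' K' L' : Type u) [CommRing R'] [Field K'] [Field L'] [Algebra R' K']
      [Algebra R' L'] [Algebra K' L'] [IsScalarTower R' K' L'],
      hasseArf R' (K := K') (L := L'))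
    (ρ : ArtinRep K V) {v : HeightOneSpectrum (𝓞 K)} {𝔓 : Ideal (absIntegers (𝓞 K) K)}
    (h𝔓 : 𝔓 ∈ v.primesAbove) :
    (GaloisRep.artinConductorExponent v ρ : ℝ) = GaloisRep.artinConductorAt (𝓞 K) 𝔓 ρ :=
  GaloisRep.natCast_artinConductorExponent_of_hasOpenInertiaKerAt_of_hasseArf_charZero hHA h𝔓 ρ
    (Nat.cast_ne_zero.mpr (HeightOneSpectrum.one_lt_residueCard v).ne_bot)
    (GaloisRep.HasOpenInertiaKerAt.of_isOpen_ker 𝔓 ρ.isOpen_ker)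

/-- **Neukirch VII (12.3) (i) for all Artin representations, conditionally on Hasse–Arf**:
`Λ(s, ρ ⊕ ρ') = Λ(s, ρ) Λ(s, ρ')` on `re s > 1` (`completedArtinLFunction_prod_of_natCast` with
`natCast_artinConductorExponent_of_hasseArf`). [cite: NeukirchANT1999, VII (12.3) (i)] -/
theorem completedArtinLFunction_prod_of_hasseArf
    (hHA : ∀ (R' K' L' : Type u) [CommRing R'] [Field K'] [Field L'] [Algebra R' K']
      [Algebra R' L'] [Algebra K' L'] [IsScalarTower R' K' L'],
      hasseArf R' (K := K') (L := L'))
    (ρ : ArtinRep K V) (ρ' : ArtinRep K V') {s : ℂ} (hs : 1 < s.re) :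
    completedArtinLFunction (V := V × V') (ρ.prod ρ') s =
      completedArtinLFunction ρ s * completedArtinLFunction ρ' s :=
  completedArtinLFunction_prod_of_natCast ρ ρ'
    (fun _ _ h𝔓 => ⟨_, ArtinRep.natCast_artinConductorExponent_of_hasseArf hHA ρ h𝔓⟩)
    (fun _ _ h𝔓 => ⟨_, ArtinRep.natCast_artinConductorExponent_of_hasseArf hHA ρ' h𝔓⟩) hs

end HasseArf

end Literature.NumberTheory.GaloisRepresentations

end
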